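import Literature.Analysis.FluidPDE.TaoClassGlue
import Literature.Analysis.FluidPDE.AxisymVorticityAlgebra
import HarnessLib

/-!
# Uniform slab bounds in Tao's smooth class for the axisymmetric no-swirl a-priori estimate

Analysis/FluidPDE proof file (all results proved, no definitions) on the decomposition path of
the named fact `Literature.Analysis.FluidPDE.axisymmetricNoSwirl_enstrophy_apriori`
(Lemarié-Rieusset 2016, Thm. 10.4). The weighted estimates of `LadyzhenskayaWeightedEstimate`
and `AxisymNoSwirlEnstrophyIneq` are stated for classical solutions with a handful of uniform
bounds on the closed slab; this file derives those bounds from the hypotheses of Tao's smooth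
class (`IsTaoSolutionOn`: all `L²` Sobolev norms of `u(t)` bounded on `[0, T]`):

* `exists_forall_hadamardQuotFst_curl_le` — sup bounds for `f = ω_θ/r` and `∇f`
  (`f(t) = hadamardQuotFst ((curl u(t))₁)`): the Sobolev imbedding `H² ⊂ C_B`
  (`FunctionSpaces.exists_enorm_le_sobolev_two_two_dim_three`) applied to `Dω₁` and `D∂₀ω₁`,
  fixed linear images of `D²u`, `D³u`, followed by the sup bounds for Hadamard quotients;
* `integrable_norm_curl_sq`, `integrable_frobeniusNormSq_fderiv_curl`,
  `integrable_hadamardQuotFst_curl_sq`, `integrable_stretch_density` — `ω, ∇ω, f ∈ L²` with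
  the explicit bounds `‖ω‖₂² ≤ κ²‖Du‖₂²`, `‖∇ω‖²_F ≤ 3κ²‖D²u‖₂²`, `‖f‖₂² ≤ 3κ²‖D²u‖₂²`
  (`κ = ‖curlCLM‖`; the last is `‖ω/r‖₂ ≤ ‖ω‖_{Ḣ¹}`, Lemarié-Rieusset 2016, p. 286), and
  integrability of the stretching density `|f| |ω| |u|`.

## References

* P. G. Lemarié-Rieusset, *The Navier–Stokes Problem in the 21st Century*, CRC Press (2016),
  §10.3, proof of Thm. 10.4, pp. 284–286. [LemarieRieusset2016]
* R. A. Adams, J. J. F. Fournier, *Sobolev Spaces*, 2nd ed. (2003), Thm. 4.12. [AdamsFournier2003]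
-/

noncomputable section

open Set Function Filter MeasureTheory Metric
open scoped RealInnerProductSpace ENNReal NNReal Topology

namespace Literature.Analysis.FluidPDE

/-! ### Sup bounds for `f = ω_θ/r` and `∇f` from bounded Sobolev norms -/

section HadamardBounds

/-- `L²` bound of the derivatives of a linear image: if `‖D^{j+k} v‖²_{L²} ≤ C` and
`‖D^j h‖ ≤ c ‖D^{j+k} v‖` pointwise, then `‖D^j h‖_{L²} ≤ (c² C)^{1/2}`. [folklore] -/
theorem eLpNorm_two_le_of_pointwise {F G : Type*} [NormedAddCommGroup F] [NormedAddCommGroup G]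
    {h : EuclideanSpace ℝ (Fin 3) → F} {g : EuclideanSpace ℝ (Fin 3) → G} {c : ℝ} (hc : 0 ≤ c)
    (hpt : ∀ y, ‖h y‖ ≤ c * ‖g y‖) {C : ℝ≥0} (hC : ∫⁻ y, ‖g y‖ₑ ^ 2 ≤ C) :
    eLpNorm h 2 volume ≤ (ENNReal.ofReal (c ^ 2) * C) ^ (1 / 2 : ℝ) := by
  refine eLpNorm_two_le_rpow_of_lintegral_sq_le ?_
  calc ∫⁻ y, ‖h y‖ₑ ^ 2 ≤ ∫⁻ y, ENNReal.ofReal (c ^ 2) * ‖g y‖ₑ ^ 2 := by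
        refine lintegral_mono fun y => ?_
        have h1 : ‖h y‖ₑ ≤ ENNReal.ofReal c * ‖g y‖ₑ := by
          rw [← ofReal_norm, ← ofReal_norm, ← ENNReal.ofReal_mul hc]
          exact ENNReal.ofReal_le_ofReal (hpt y)
        calc ‖h y‖ₑ ^ 2 ≤ (ENNReal.ofReal c * ‖g y‖ₑ) ^ 2 := pow_le_pow_left' h1 2
          _ = ENNReal.ofReal (c ^ 2) * ‖g y‖ₑ ^ 2 := by
              rw [mul_pow, ENNReal.ofReal_pow hc]
    _ = ENNReal.ofReal (c ^ 2) * ∫⁻ y, ‖g y‖ₑ ^ 2 := lintegral_const_mul' _ _ ENNReal.ofReal_ne_top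
    _ ≤ ENNReal.ofReal (c ^ 2) * C := mul_le_mul_right hC _

/-- **Uniform slab bounds for `f = ω_θ/r` and `∇f`** (Sobolev imbedding `H² ⊂ C_B` applied to
`Dω₁` and `D∂₀ω₁`, which are fixed linear images of `D²u`, `D³u` and have their `L²` Sobolev
norms bounded on `[0, T]` in Tao's class; then the sup bounds for the Hadamard quotient and its
derivative, `HadamardQuotient.norm_hadamardQuotFst_le`, `norm_fderiv_hadamardQuotFst_le`): there
are `F, G` with `|f(t, x)| ≤ F`, `‖Df(t)(x)‖ ≤ G` on `[0, T] × ℝ³`,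
`f(t) = hadamardQuotFst ((curl u(t))₁)`.
[cite: AdamsFournier2003, Thm. 4.12 Part I Case A (mp > n)] -/
theorem exists_forall_hadamardQuotFst_curl_le {T : ℝ}
    {u : ℝ → EuclideanSpace ℝ (Fin 3) → EuclideanSpace ℝ (Fin 3)}
    (hu : ∀ t ∈ Icc 0 T, ContDiff ℝ 5 (u t)) (hH : HasBoundedSobolevNormsOn (Icc 0 T) u) :
    ∃ F G : ℝ, ∀ t ∈ Icc 0 T, ∀ x,
      |hadamardQuotFst (fun y => curl (u t) y 1) x| ≤ F ∧
        ‖fderiv ℝ (hadamardQuotFst (fun y => curl (u t) y 1)) x‖ ≤ G := by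
  obtain ⟨K, hK, hS⟩ := FunctionSpaces.exists_enorm_le_sobolev_two_two_dim_three
    (E := EuclideanSpace ℝ (Fin 3)) (F := EuclideanSpace ℝ (Fin 3) →L[ℝ] ℝ)
    (volume : Measure (EuclideanSpace ℝ (Fin 3))) finrank_euclideanSpace_fin
  choose C hC using hH
  -- the two fixed linear maps
  set P : (EuclideanSpace ℝ (Fin 3) →L[ℝ] EuclideanSpace ℝ (Fin 3)) →L[ℝ] ℝ :=
    (EuclideanSpace.proj (1 : Fin 3) : EuclideanSpace ℝ (Fin 3) →L[ℝ] ℝ).comp curlCLM with hP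
  set A : (EuclideanSpace ℝ (Fin 3) →L[ℝ] ℝ) →L[ℝ] ℝ :=
    ContinuousLinearMap.apply ℝ ℝ (EuclideanSpace.single (0 : Fin 3) (1 : ℝ)) with hA
  -- finite Sobolev majorants
  set RF : ℝ≥0∞ := K * ∑ j ∈ Finset.range 3,
    (ENNReal.ofReal (‖P‖ ^ 2) * (C (j + 2) : ℝ≥0∞)) ^ (1 / 2 : ℝ) with hRF
  set RG : ℝ≥0∞ := K * ∑ j ∈ Finset.range 3,
    (ENNReal.ofReal ((‖A‖ * ‖P‖) ^ 2) * (C (j + 3) : ℝ≥0∞)) ^ (1 / 2 : ℝ) with hRG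
  have hRFtop : RF < ⊤ := by
    refine ENNReal.mul_lt_top hK (ENNReal.sum_lt_top.2 fun j _ => ?_)
    exact ENNReal.rpow_lt_top_of_nonneg (by norm_num)
      (ENNReal.mul_ne_top ENNReal.ofReal_ne_top ENNReal.coe_ne_top)
  have hRGtop : RG < ⊤ := by
    refine ENNReal.mul_lt_top hK (ENNReal.sum_lt_top.2 fun j _ => ?_)
    exact ENNReal.rpow_lt_top_of_nonneg (by norm_num)
      (ENNReal.mul_ne_top ENNReal.ofReal_ne_top ENNReal.coe_ne_top)
  refine ⟨RF.toReal, RG.toReal, fun t ht x => ?_⟩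
  -- the slice and its scalar `ω₁ = P ∘ Du`
  set v := u t with hv
  have hvs : ContDiff ℝ 5 v := hu t ht
  set w : EuclideanSpace ℝ (Fin 3) → ℝ := fun y => curl v y 1 with hwdef
  have hw_eq : w = P ∘ fderiv ℝ v := by funext y; rfl
  have hDv : ContDiff ℝ 4 (fderiv ℝ v) := hvs.fderiv_right (m := 4) (by norm_cast)
  have hw4 : ContDiff ℝ 4 w := by rw [hw_eq]; exact P.contDiff.comp hDv
  have hw2 : ContDiff ℝ 2 w := hw4.of_le (by norm_cast)
  have hDw : ContDiff ℝ 3 (fderiv ℝ w) := hw4.fderiv_right (m := 3) (by norm_cast)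
  set dw : EuclideanSpace ℝ (Fin 3) → ℝ := fun y => fderiv ℝ w y (EuclideanSpace.single 0 1)
    with hdwdef
  have hdw_eq : dw = A ∘ fderiv ℝ w := by funext y; rfl
  have hdw3 : ContDiff ℝ 3 dw := by rw [hdw_eq]; exact A.contDiff.comp hDw
  have hDdw : ContDiff ℝ 2 (fderiv ℝ dw) := hdw3.fderiv_right (m := 2) (by norm_cast)
  -- pointwise comparison of iterated derivatives with those of `v`
  have hpt1 : ∀ j : ℕ, j ≤ 3 → ∀ y, ‖iteratedFDeriv ℝ j (fderiv ℝ w) y‖ ≤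
      ‖P‖ * ‖iteratedFDeriv ℝ (j + 2) v y‖ := by
    intro j hj y
    rw [norm_iteratedFDeriv_fderiv, hw_eq]
    have hj4 : j + 1 ≤ 4 := by omega
    have hj' : ((j + 1 : ℕ) : WithTop ℕ∞) ≤ 4 := by exact_mod_cast hj4
    refine (P.norm_iteratedFDeriv_comp_left (hDv.contDiffAt) hj').trans ?_
    rw [norm_iteratedFDeriv_fderiv]
  have hpt2 : ∀ j : ℕ, j ≤ 2 → ∀ y, ‖iteratedFDeriv ℝ j (fderiv ℝ dw) y‖ ≤
      (‖A‖ * ‖P‖) * ‖iteratedFDeriv ℝ (j + 3) v y‖ := by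
    intro j hj y
    rw [norm_iteratedFDeriv_fderiv, hdw_eq]
    have hj3 : j + 1 ≤ 3 := by omega
    have hj' : ((j + 1 : ℕ) : WithTop ℕ∞) ≤ 3 := by exact_mod_cast hj3
    refine (A.norm_iteratedFDeriv_comp_left (hDw.contDiffAt) hj').trans ?_
    rw [mul_assoc]
    exact mul_le_mul_of_nonneg_left (hpt1 (j + 1) hj3 y) (norm_nonneg _)
  -- Sobolev imbedding for `Dω₁` and `D∂₀ω₁`
  have hbF : ∀ j ∈ Finset.range 3, eLpNorm (iteratedFDeriv ℝ j (fderiv ℝ w)) 2 volume ≤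
      (ENNReal.ofReal (‖P‖ ^ 2) * (C (j + 2) : ℝ≥0∞)) ^ (1 / 2 : ℝ) := fun j hj =>
    eLpNorm_two_le_of_pointwise (norm_nonneg P)
      (hpt1 j (by simp only [Finset.mem_range] at hj; omega)) (hC (j + 2) t ht)
  have hbG : ∀ j ∈ Finset.range 3, eLpNorm (iteratedFDeriv ℝ j (fderiv ℝ dw)) 2 volume ≤
      (ENNReal.ofReal ((‖A‖ * ‖P‖) ^ 2) * (C (j + 3) : ℝ≥0∞)) ^ (1 / 2 : ℝ) := fun j hj =>
    eLpNorm_two_le_of_pointwise (by positivity)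
      (hpt2 j (by simp only [Finset.mem_range] at hj; omega)) (hC (j + 3) t ht)
  have hFy : ∀ y, ‖fderiv ℝ w y‖ ≤ RF.toReal := fun y => by
    have h1 : ‖fderiv ℝ w y‖ₑ ≤ RF := by
      refine (hS _ (hDw.of_le (by norm_cast)) y).trans ?_
      rw [hRF]
      gcongr with j hj
      exact hbF j hj
    calc ‖fderiv ℝ w y‖ = (‖fderiv ℝ w y‖ₑ).toReal := (toReal_enorm _).symm
      _ ≤ RF.toReal := ENNReal.toReal_mono hRFtop.ne h1
  have hGy : ∀ y, ‖fderiv ℝ dw y‖ ≤ RG.toReal := fun y => by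
    have h1 : ‖fderiv ℝ dw y‖ₑ ≤ RG := by
      refine (hS _ hDdw y).trans ?_
      rw [hRG]
      gcongr with j hj
      exact hbG j hj
    calc ‖fderiv ℝ dw y‖ = (‖fderiv ℝ dw y‖ₑ).toReal := (toReal_enorm _).symm
      _ ≤ RG.toReal := ENNReal.toReal_mono hRGtop.ne h1
  refine ⟨?_, norm_fderiv_hadamardQuotFst_le hw2 hGy x⟩
  rw [← Real.norm_eq_abs]
  exact norm_hadamardQuotFst_le hFy x

end HadamardBounds

/-! ### Square integrability of `ω`, `∇ω`, `f` and of the stretching density -/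

section Integrability

variable {v : EuclideanSpace ℝ (Fin 3) → EuclideanSpace ℝ (Fin 3)}

/-- `∫ ‖h‖² = (∫⁻ ‖h‖ₑ²).toReal` for continuous `h`. [folklore] -/
theorem integral_sq_norm_eq_toReal {F : Type*} [NormedAddCommGroup F]
    {h : EuclideanSpace ℝ (Fin 3) → F} (hc : Continuous h) :
    ∫ x, ‖h x‖ ^ 2 = (∫⁻ x, ‖h x‖ₑ ^ 2).toReal := by
  rw [integral_eq_lintegral_of_nonneg_ae (ae_of_all _ fun x => sq_nonneg _)
    (hc.norm.pow 2).aestronglyMeasurable]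
  congr 1
  refine lintegral_congr fun x => ?_
  rw [← ofReal_norm, ENNReal.ofReal_pow (norm_nonneg _)]

/-- **`ω ∈ L²` with `‖ω‖₂² ≤ κ² ‖Dv‖₂²`** for `v ∈ C²` with `Dv ∈ L²`. [folklore] -/
theorem integrable_norm_curl_sq (hv : ContDiff ℝ 2 v)
    (h1 : ∫⁻ x, ‖iteratedFDeriv ℝ 1 v x‖ₑ ^ 2 < ⊤) :
    Integrable (fun x => ‖curl v x‖ ^ 2) ∧
      ∫ x, ‖curl v x‖ ^ 2 ≤ ‖curlCLM‖ ^ 2 * (∫⁻ x, ‖iteratedFDeriv ℝ 1 v x‖ₑ ^ 2).toReal := by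
  have hv1 : ContDiff ℝ 1 v := hv.of_le (by norm_cast)
  have hgc : Continuous (iteratedFDeriv ℝ 1 v) := hv.continuous_iteratedFDeriv (by norm_cast)
  have hg : Integrable fun x => ‖iteratedFDeriv ℝ 1 v x‖ ^ 2 :=
    integrable_sq_norm_of_lintegral_lt_top hgc h1
  have hωc : Continuous (curl v) := (contDiff_curl (n := 1) (by exact_mod_cast hv)).continuous
  have hpt : ∀ x, ‖curl v x‖ ^ 2 ≤ ‖curlCLM‖ ^ 2 * ‖iteratedFDeriv ℝ 1 v x‖ ^ 2 := fun x => by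
    rw [norm_iteratedFDeriv_one, ← mul_pow]
    exact pow_le_pow_left₀ (norm_nonneg _) (norm_curl_le v x) 2
  have hint : Integrable fun x => ‖curl v x‖ ^ 2 :=
    (hg.const_mul _).mono' (hωc.norm.pow 2).aestronglyMeasurable (ae_of_all _ fun x => by
      rw [Real.norm_eq_abs, abs_of_nonneg (sq_nonneg _)]; exact hpt x)
  refine ⟨hint, ?_⟩
  calc ∫ x, ‖curl v x‖ ^ 2 ≤ ∫ x, ‖curlCLM‖ ^ 2 * ‖iteratedFDeriv ℝ 1 v x‖ ^ 2 :=
        integral_mono hint (hg.const_mul _) hpt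
    _ = ‖curlCLM‖ ^ 2 * (∫⁻ x, ‖iteratedFDeriv ℝ 1 v x‖ₑ ^ 2).toReal := by
        rw [MeasureTheory.integral_const_mul, integral_sq_norm_eq_toReal hgc]

/-- **`∇ω ∈ L²` with `∫|Dω|²_F ≤ 3κ² ‖D²v‖₂²`** for `v ∈ C³` with `D²v ∈ L²`. [folklore] -/
theorem integrable_frobeniusNormSq_fderiv_curl (hv : ContDiff ℝ 3 v)
    (h2 : ∫⁻ x, ‖iteratedFDeriv ℝ 2 v x‖ₑ ^ 2 < ⊤) :
    Integrable (fun x => frobeniusNormSq (fderiv ℝ (curl v) x)) ∧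
      ∫ x, frobeniusNormSq (fderiv ℝ (curl v) x) ≤
        3 * ‖curlCLM‖ ^ 2 * (∫⁻ x, ‖iteratedFDeriv ℝ 2 v x‖ₑ ^ 2).toReal := by
  have hv2 : ContDiff ℝ 2 v := hv.of_le (by norm_cast)
  have hgc : Continuous (iteratedFDeriv ℝ 2 v) := hv.continuous_iteratedFDeriv (by norm_cast)
  have hg : Integrable fun x => ‖iteratedFDeriv ℝ 2 v x‖ ^ 2 :=
    integrable_sq_norm_of_lintegral_lt_top hgc h2
  have hω1 : ContDiff ℝ 1 (curl v) := contDiff_curl (n := 1) (by exact_mod_cast hv2)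
  have hFc : Continuous fun x => frobeniusNormSq (fderiv ℝ (curl v) x) :=
    continuous_frobeniusNormSq_fderiv hω1 one_ne_zero
  have hpt : ∀ x, frobeniusNormSq (fderiv ℝ (curl v) x) ≤
      3 * ‖curlCLM‖ ^ 2 * ‖iteratedFDeriv ℝ 2 v x‖ ^ 2 := fun x => by
    refine (frobeniusNormSq_le_three_mul _).trans ?_
    rw [mul_assoc, ← mul_pow]
    exact mul_le_mul_of_nonneg_left (pow_le_pow_left₀ (norm_nonneg _) (norm_fderiv_curl_le hv2 x) 2)
      (by norm_num)
  have hint : Integrable fun x => frobeniusNormSq (fderiv ℝ (curl v) x) :=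
    (hg.const_mul _).mono' hFc.aestronglyMeasurable (ae_of_all _ fun x => by
      rw [Real.norm_eq_abs, abs_of_nonneg (frobeniusNormSq_nonneg _)]; exact hpt x)
  refine ⟨hint, ?_⟩
  calc _ ≤ ∫ x, 3 * ‖curlCLM‖ ^ 2 * ‖iteratedFDeriv ℝ 2 v x‖ ^ 2 :=
        integral_mono hint (hg.const_mul _) hpt
    _ = 3 * ‖curlCLM‖ ^ 2 * (∫⁻ x, ‖iteratedFDeriv ℝ 2 v x‖ₑ ^ 2).toReal := by
        rw [MeasureTheory.integral_const_mul, integral_sq_norm_eq_toReal hgc]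

/-- **`f = ω_θ/r ∈ L²` with `∫ f² ≤ 3κ² ‖D²v‖₂²`** for an axisymmetric swirl-free `v ∈ C³` with
`D²v ∈ L²` (pointwise `f² ≤ |Dω|²_F`, `AxisymVorticityAlgebra`; this is
`‖ω/r‖₂ ≤ ‖ω‖_{Ḣ¹}`, Lemarié-Rieusset 2016, p. 286). [cite: LemarieRieusset2016, §10.3 p. 286] -/
theorem integrable_hadamardQuotFst_curl_sq (hv : ContDiff ℝ 3 v) (hax : IsAxisymmetric v)
    (hsw : HasNoSwirl v) (h2 : ∫⁻ x, ‖iteratedFDeriv ℝ 2 v x‖ₑ ^ 2 < ⊤) :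
    Integrable (fun x => hadamardQuotFst (fun y => curl v y 1) x ^ 2) ∧
      ∫ x, hadamardQuotFst (fun y => curl v y 1) x ^ 2 ≤
        3 * ‖curlCLM‖ ^ 2 * (∫⁻ x, ‖iteratedFDeriv ℝ 2 v x‖ₑ ^ 2).toReal := by
  obtain ⟨hFi, hFle⟩ := integrable_frobeniusNormSq_fderiv_curl hv h2
  have hv2 : ContDiff ℝ 2 v := hv.of_le (by norm_cast)
  have hf1 : ContDiff ℝ 1 (hadamardQuotFst (fun y => curl v y 1)) :=
    contDiff_hadamardQuotFst_curl (n := 1) (by exact_mod_cast hv)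
  have hω : curl v = fun y => hadamardQuotFst (fun y => curl v y 1) y • rotGen y :=
    funext fun y => curl_eq_hadamardQuotFst_smul_rotGen hax hsw hv2 y
  have hpt : ∀ x, hadamardQuotFst (fun y => curl v y 1) x ^ 2 ≤
      frobeniusNormSq (fderiv ℝ (curl v) x) := fun x =>
    sq_le_frobeniusNormSq_fderiv_of_eq_smul_rotGen hω ((hf1.differentiable one_ne_zero) x)
  have hint : Integrable fun x => hadamardQuotFst (fun y => curl v y 1) x ^ 2 :=
    hFi.mono' (hf1.continuous.pow 2).aestronglyMeasurable (ae_of_all _ fun x => by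
      rw [Real.norm_eq_abs, abs_of_nonneg (sq_nonneg _)]; exact hpt x)
  exact ⟨hint, (integral_mono hint hFi hpt).trans hFle⟩

/-- **The stretching density `|f| |ω| |u|` is integrable** when `f, ω ∈ L²` and `|u| ≤ V`
(`|f| |ω| |u| ≤ V (f² + |ω|²)/2`). [folklore] -/
theorem integrable_stretch_density (hv : ContDiff ℝ 3 v) {V : ℝ} (hV : ∀ x, ‖v x‖ ≤ V)
    (hf : Integrable fun x => hadamardQuotFst (fun y => curl v y 1) x ^ 2)
    (hω : Integrable fun x => ‖curl v x‖ ^ 2) :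
    Integrable fun x => |hadamardQuotFst (fun y => curl v y 1) x| * ‖curl v x‖ * ‖v x‖ := by
  have hv2 : ContDiff ℝ 2 v := hv.of_le (by norm_cast)
  have hf1 : ContDiff ℝ 1 (hadamardQuotFst (fun y => curl v y 1)) :=
    contDiff_hadamardQuotFst_curl (n := 1) (by exact_mod_cast hv)
  have hωc : Continuous (curl v) := (contDiff_curl (n := 1) (by exact_mod_cast hv2)).continuous
  have hV0 : 0 ≤ V := (norm_nonneg _).trans (hV 0)
  refine ((hf.add hω).const_mul (V / 2)).mono'
    (((continuous_abs.comp hf1.continuous).mul hωc.norm).mul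
      hv.continuous.norm).aestronglyMeasurable
    (ae_of_all _ fun x => ?_)
  rw [Real.norm_eq_abs, abs_of_nonneg (by positivity)]
  have h1 : |hadamardQuotFst (fun y => curl v y 1) x| * ‖curl v x‖ ≤
      (hadamardQuotFst (fun y => curl v y 1) x ^ 2 + ‖curl v x‖ ^ 2) / 2 := by
    nlinarith [sq_nonneg (|hadamardQuotFst (fun y => curl v y 1) x| - ‖curl v x‖),
      sq_abs (hadamardQuotFst (fun y => curl v y 1) x)]
  calc _ ≤ (hadamardQuotFst (fun y => curl v y 1) x ^ 2 + ‖curl v x‖ ^ 2) / 2 * V :=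
        mul_le_mul h1 (hV x) (norm_nonneg _) (by positivity)
    _ = V / 2 * (hadamardQuotFst (fun y => curl v y 1) x ^ 2 + ‖curl v x‖ ^ 2) := by ring

end Integrability

end Literature.Analysis.FluidPDE

end
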